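import Literature.MathematicalPhysics.QuantumFieldTheory.Balaban1983to89.B6Ineq2142KLevelV1
import Literature.MathematicalPhysics.QuantumFieldTheory.Balaban1983to89.B3TorusRadialSums
import Literature.MathematicalPhysics.QuantumFieldTheory.Balaban1983to89.B6
import HarnessLib

/-!
# `Balaban1983to89.B6KLevelCensusIndexV1` — T. Bałaban, *Propagators and renormalization transformations for lattice gauge theories. II*,
Comm. Math. Phys. **96** (1984) 223–250 [Balaban1984PropagatorsII], pp. 224 (2.1)–(2.4), 225 (2.16), 229–231 (2.45)–(2.48), 247 (2.136)–(2.140),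
249 (2.149)–(2.151): **THE INDEX OF THE GENUINE k-LEVEL V1 FAMILY AND ITS TWO READINGS AS A `…B6.Geometry`** — the common frame on which the
verbatim census typings `B6.Prop27Printed` / `B6.Cor28Printed` (kernels on 𝔅 read as index BONDS, p. 248 «with sites replaced by bonds»:
`kGeo`) and `B6.Prop26Printed` (operators on functions of the FINE bonds, localised by the blocks `Δ(y)`, `y ∈ 𝔅`: `kGeoG`) are inhabited at
every number of levels `k ≥ 2` (B6-CLOSURE §5 items 19–21; fold owner r03).

HONEST FRAMING (programme rule): statement-level skeleton of published theorems with citation tags; proofs where landed; nothing here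
is a claim about the Yang–Mills mass gap.

PRINT (verbatim where quoted).  p. 224: «𝔅 = ⋃_j Λ_j» with the scales `L^jη` ((2.1)–(2.4)), «(L^jη)⁻¹dist(Ω_j^c, Ω_{j+1}) > RM» (2.2);
p. 225 (2.16): the weights `a_j(L^jη)^{−2}` of the averaging term; pp. 229–231: the multiscale distance `d(y, y′)` (2.46) and the localisation
vocabulary — cubes `Δ(y)` («Δ(y) = B^j(y) if y ∈ Λ_j», p. 232), `Δ̃(y)` («a sum of 2^d unit cubes on the L^{−j}-scale, having y as a corner»,
p. 247), cut-offs `ζ`, `|·|`, `‖·‖_α`; p. 247 (2.136)–(2.140): «x ∈ Δ(y), y ∈ Λ_j, supp J ⊂ Δ(y′)», «‖J‖^{ξ′}_ε …, ξ′ = L^{−j′}»; p. 248: «We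
consider these operators on the L²-space defined by (2.69) with sites replaced by bonds»; [4] = *… I*, CMP **95** (1984) (1.109) p. 35: the
Hölder quotient `|x − x′|^{−α}|A(x) − A(x′)|` over pairs `|x − x′| ≤ 1` at the scale `ξ`.

## WHAT THIS FILE DECLARES (definitions with bodies + elementary theorems; no `def … : Prop` fact; standard axioms)

* §1 **`KIdx d ℓ hd hL b₀ b₁`** — the index record of the genuine k-level family: the binder list of ROUTE V/W (V1 parameters `(m, K)`, a nested
  k-level torus family `D : TDomains` with `M_h = Lᵃ ≥ 8`, `R ≥ 2L²`, `P′ ≥ 5`, odd `L ≥ 5`, `k ≥ 2`, every cube placed, a fine-lattice factor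
  `c_f ≠ 0`, weights `w` in the band (2.16)); the «M sufficiently large» thresholds are NOT fields — they are the census threshold `M₁ ≤ M`.
* §2 **`Adm`**, **`tpar`** — ADMISSIBLE ordered pairs of fine bonds (same direction, `|x − x′|_∞ ≤ L^{j(y(x))}` and `≤ L^{j(y(x′))}`: print's
  «x, x′ ∈ Δ̃(y)», the Hölder quotient at the scale `ξ = L^{−j}`; the reading of p22's `B6Ineq2137GradKLevelV1`) and the pair parameter
  `t = |x − x′|_∞/L^{j(y(x))}` (`≤ 1` on admissible pairs: `tpar_le_one`; `adm_symm`, `tpar_nonneg`).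
* §3 **`kGeo i`** (`Site := 𝔅` as INDEX BONDS, `scale := level`, `η := |c_f|⁻¹`, `dist := d_T(βb, βb′)` = p21's torus distance (2.46) of the
  carrier blocks, `M := L·M_h`; the `Loc` slots are the coarse bond-function readings (unused by Prop. 2.7/Cor. 2.8), the `Cut` slots the
  Hölder-pair readings `cutIn ζ b` = «supp ζ within torus distance 1 of the block of b», `cutH α ζ = |ζ| + ‖ζ‖^ξ_α`), `len_eq`, `len_pos` —
  the geometry of `B6.Prop27Printed`/`B6.Cor28Printed` at k levels.
* §4 **`kGeoG i`** (`Site := 𝔅` as BLOCKS `y` (p21's `geomT D`), `scale y := j(y)`, same `η, dist, M`; `Loc :=` functions `J` on the FINE bonds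
  with `suppIn J y′` = «supp J ⊂ Δ(y′)» (every bond where `J ≠ 0` lies in the block `y′`), `supNorm J = |J| = sup|J(x)|`, `l2Norm J = ‖J‖` (flat
  `ℓ²`; print's `η^d`-weights of (2.69) cancel between the two sides of (2.140)), `holder ε J = ‖J‖^{ξ′}_ε` = sup over admissible ordered pairs of
  `t^{−ε}|J(x) − J(x′)|`; `Cut` slots as in `kGeo` with `cutIn ζ y` = «supp ζ within torus distance 1 of y» ⊇ Δ̃(y)), `lenG_eq`, `lenG_pos`,
  `lenG_eq_geomT` (`(L^{scale}η)(y) = (geomT D).len y·|c_f|⁻¹`, the slot prefactor of the k-level (2.136) files), `abs_le_supNormG`,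
  **`blockSupp_of_suppIn`** (the census hypothesis «supp J ⊂ Δ(y′)» IS `B6RandomWalk.BlockSupp (blkV1) J y′ |J|`, the input of every k-level
  `HasMajorant` statement) — the geometry of `B6.Prop26Printed` at k levels.

## HONEST SCOPE

(1) Readings, not theorems of print: `dist` is p21's torus graph distance of blocks (it dominates the printed (2.46) up to `d + 1`), `η = |c_f|⁻¹`
in lattice units, `cutIn`/`suppIn` are the block-localisations named above (`cutIn` is WEAKER than «supp ζ ⊂ Δ̃(y)» — more cut-offs admitted — so a
census proved on it is not weaker than print).  (2) The family is the V1 torus family of ROUTE V/W (`k ≥ 2`; for odd `L ≥ 7` the placement field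
must be supplied by the user; non-vacuity at `L = 5` is `B6KLevelFamilyWitnessV1.kLevelFamily_nonvacuous_L5`).  (3) No inequality of print is
claimed here; the censuses live in `B6Prop27PrintedKLevelV1`, `B6Cor28PrintedKLevelV1` (staged, B6-CLOSURE §5 items 19–20) and the future
Prop. 2.6 census (item 21).  DEFINITIONS (data) + THEOREMS; no `def … : Prop`.  NOT summit progress.  Unit `lit-balaban-r03` (gen 26), 2026-08-24.
-/

noncomputable section

namespace Literature.MathematicalPhysics.QuantumFieldTheory.Balaban1983to89.B6KLevelCensusIndexV1

open LatticeFieldCalculus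
open B6SectAOperatorsV1 (BondIdx BondIdxSpace)
open B6MultiLevelBoxOperator (N0)
open B6MultiLevelTorusOperator (TDomains)
open B6GlobalChartV1 (PV domT blkV1)
open B6Geom246MultiLevelBox (bset)
open B6Geom246MultiLevelTorus (geomT)
open B6RandomWalk (BlockSupp)
open B6Ineq2142KLevelV1 (lvl β)
open B6CubeWindowV1 (Placed GlobalBand)
open B6Cover236MultiLevelBlocks (cubes)
open B3TorusRadialSums (supDist_comm)

variable (d ℓ : ℕ) (hd : 1 ≤ d + 1) (hL : Odd (ℓ + 1) ∧ 1 < ℓ + 1) (b₀ b₁ : ℝ)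

/-! ## §1  The index of the genuine k-level family -/

/-- **the index of the genuine k-level family**: the binder list of ROUTE V/W (V1 parameters, a nested torus family with `M_h = L^a ≥ 8`, `R ≥ 2L²`,
`P′ ≥ 5`, odd `L ≥ 5`, `k ≥ 2`, every cube placed, `c_f ≠ 0`, weights in the band (2.16)); the «M sufficiently large» thresholds are NOT fields —
they are the census threshold `M₁ ≤ M`. [cite: Balaban1984PropagatorsII, (2.1)–(2.4) p.224, (2.16) p.225, (2.20) p.226] -/
structure KIdx where
  m : ℕ
  K : ℕ
  Mh : ℕ
  k : ℕ
  R : ℕ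
  a : ℕ
  P' : Fin (d + 1) → ℕ
  hN : ∀ μ, N0 ℓ Mh k P' μ = (PV d ℓ m K hd hL).sitesPerDir 0
  D : TDomains d ℓ Mh k P' R
  hk : k ≤ m + K
  hk2 : 2 ≤ k
  hMha : Mh = (ℓ + 1) ^ a
  hM8 : 8 ≤ Mh
  hR2 : 2 * (ℓ + 1) ^ 2 ≤ R
  hP5 : ∀ μ, 5 ≤ P' μ
  hℓ : 4 ≤ ℓ
  hpl : ∀ c : ↥(cubes D.toDomains), Placed ℓ k P' c.1
  cf : ℝ
  hcf : cf ≠ 0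
  w : BondIdx (domT hN D hk) → ℝ
  hw : ∀ i, 0 < w i
  hwb : GlobalBand b₀ b₁ cf w

variable {d ℓ hd hL b₀ b₁}

/-! ## §2  Admissible ordered pairs of fine bonds and the pair parameter `t` -/

/-- **ADMISSIBLE ordered pairs of fine bonds** (print's «x, x′ ∈ Δ̃(y)», the Hölder quotient at the scale `ξ = L^{−j}`, (2.137) p. 247; the reading of
`B6Ineq2137GradKLevelV1`): same direction, `|x − x′|_∞ ≤ L^{j(y(x))}` and `|x − x′|_∞ ≤ L^{j(y(x′))}`.
[cite: Balaban1984PropagatorsII, (2.137) p.247; Balaban1984PropagatorsI, (1.109) p.35 (reading p22/r03)] -/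
def Adm (i : KIdx d ℓ hd hL b₀ b₁) (x x' : PBond (PV d ℓ i.m i.K hd hL) 0) : Prop :=
  x.dir = x'.dir ∧ supDist x.src x'.src ≤ (ℓ + 1) ^ (blkV1 i.hN i.D x).1.1 ∧ supDist x.src x'.src ≤ (ℓ + 1) ^ (blkV1 i.hN i.D x').1.1

/-- admissibility is decidable (a direction equality and two inequalities of naturals). [cite: Balaban1984PropagatorsII, (2.137) p.247 (reading p22/r03), bookkeeping] -/
instance (i : KIdx d ℓ hd hL b₀ b₁) (x x' : PBond (PV d ℓ i.m i.K hd hL) 0) : Decidable (Adm i x x') := by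
  unfold Adm; exact inferInstance

/-- admissibility is symmetric in the pair. [cite: Balaban1984PropagatorsII, (2.137) p.247 (reading p22/r03), bookkeeping] -/
theorem adm_symm (i : KIdx d ℓ hd hL b₀ b₁) {x x' : PBond (PV d ℓ i.m i.K hd hL) 0} (h : Adm i x x') : Adm i x' x := by
  obtain ⟨h1, h2, h3⟩ := h
  exact ⟨h1.symm, by rwa [supDist_comm], by rwa [supDist_comm]⟩

/-- **the dimensionless pair parameter `t = |x − x′|_∞/L^{j(y(x))}`** (print's `|x − x′|_phys = t·L^jη`).
[cite: Balaban1984PropagatorsII, (2.137) p.247 (reading p22/r03)] -/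
def tpar (i : KIdx d ℓ hd hL b₀ b₁) (x x' : PBond (PV d ℓ i.m i.K hd hL) 0) : ℝ :=
  ((supDist x.src x'.src : ℕ) : ℝ) / (((ℓ + 1 : ℕ) : ℝ)) ^ (blkV1 i.hN i.D x).1.1

/-- `0 ≤ t`. [cite: Balaban1984PropagatorsII, (2.137) p.247, bookkeeping] -/
theorem tpar_nonneg (i : KIdx d ℓ hd hL b₀ b₁) (x x' : PBond (PV d ℓ i.m i.K hd hL) 0) : 0 ≤ tpar i x x' := by
  unfold tpar; positivity

/-- `t ≤ 1` on an admissible pair (print: the quotient over pairs `|x − x′| ≤ 1` at the scale `ξ`). [cite: Balaban1984PropagatorsII, (2.137) p.247; Balaban1984PropagatorsI, (1.109) p.35] -/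
theorem tpar_le_one (i : KIdx d ℓ hd hL b₀ b₁) {x x' : PBond (PV d ℓ i.m i.K hd hL) 0} (h : Adm i x x') : tpar i x x' ≤ 1 := by
  unfold tpar
  have hpos : (0 : ℝ) < (((ℓ + 1 : ℕ) : ℝ)) ^ (blkV1 i.hN i.D x).1.1 := by positivity
  rw [div_le_one hpos]
  exact_mod_cast h.2.1

/-! ## §3  The bond-site reading `kGeo` (Prop. 2.7 / Cor. 2.8: «sites replaced by bonds») -/

/-- **the k-level geometry of an index, sites = the index BONDS** (`Site := 𝔅`, `scale := level`, `η := |c_f|⁻¹`, `dist := d_T(β·, β·)`,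
`M := L·M_h`; the `Loc` slots are the coarse bond-function readings, unused by Prop. 2.7/Cor. 2.8; the `Cut` slots are the Hölder-pair readings: a
cut-off `ζ` is a function on the fine bonds, `cutIn ζ y` = «supp ζ ⊂ Δ̃(y)» read as «every fine bond where `ζ ≠ 0` lies in a block within torus
distance 1 of the block of `y`», and `cutH α ζ = |ζ| + ‖ζ‖^ξ_α := sup|ζ| + sup over admissible ordered pairs of `t^{−α}|ζ(x) − ζ(x′)|` — print's
`(‖ζ‖^ξ_α + |ζ|)` of (2.137)/(2.151)). [cite: Balaban1984PropagatorsII, (2.1)–(2.4) p.224, (2.45)–(2.46) pp.229–230, (2.69) p.235, (2.137) p.247, (2.151) p.249, p.248 («sites replaced by bonds»)] -/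
@[reducible] def kGeo (i : KIdx d ℓ hd hL b₀ b₁) : B6.Geometry where
  Site := BondIdx (domT i.hN i.D i.hk)
  fin := inferInstance
  scale := fun b => lvl i.hN i.D i.hk b
  dist := fun b b' => (geomT i.D).dist (β i.hN i.D i.hk b) (β i.hN i.D i.hk b')
  k := i.k
  eta := |i.cf|⁻¹
  L := ((ℓ + 1 : ℕ) : ℝ)
  R := i.R
  M := ((ℓ + 1 : ℕ) : ℝ) * (i.Mh : ℝ)
  Hyp21_22 := True
  Loc := BondIdxSpace (domT i.hN i.D i.hk)
  suppIn := fun B c => ∀ b, B b ≠ 0 → β i.hN i.D i.hk b = β i.hN i.D i.hk c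
  supNorm := fun B => ⨆ b, |B b|
  l2Norm := fun B => ‖B‖
  holder := fun _ B => ⨆ q : BondIdx (domT i.hN i.D i.hk) × BondIdx (domT i.hN i.D i.hk), |B q.1 - B q.2|
  Cut := PBond (PV d ℓ i.m i.K hd hL) 0 → ℝ
  cutIn := fun ζ c => ∀ f, ζ f ≠ 0 → (geomT i.D).dist (blkV1 i.hN i.D f) (β i.hN i.D i.hk c) ≤ 1
  cutH := fun α ζ => (⨆ f, |ζ f|) +
    ⨆ q : PBond (PV d ℓ i.m i.K hd hL) 0 × PBond (PV d ℓ i.m i.K hd hL) 0, if Adm i q.1 q.2 then tpar i q.1 q.2 ^ (-α) * |ζ q.1 - ζ q.2| else 0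
  cutSup := fun ζ => ⨆ f, |ζ f|

/-- `(L^{scale}η)(b) = L^{j(b)}/|c_f|`. [cite: Balaban1984PropagatorsII, (2.1) p.224] -/
theorem len_eq (i : KIdx d ℓ hd hL b₀ b₁) (b : BondIdx (domT i.hN i.D i.hk)) :
    (kGeo i).len b = (((ℓ + 1 : ℕ) : ℝ)) ^ (lvl i.hN i.D i.hk b) / |i.cf| := by
  show (((ℓ + 1 : ℕ) : ℝ)) ^ (lvl i.hN i.D i.hk b) * |i.cf|⁻¹ = _
  rw [div_eq_mul_inv]

/-- `(L^{scale}η)(b) > 0`. [cite: Balaban1984PropagatorsII, (2.1) p.224, bookkeeping] -/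
theorem len_pos (i : KIdx d ℓ hd hL b₀ b₁) (b : BondIdx (domT i.hN i.D i.hk)) : 0 < (kGeo i).len b := by
  rw [len_eq]
  have : 0 < |i.cf| := abs_pos.2 i.hcf
  positivity

/-! ## §4  The block-site reading `kGeoG` (Prop. 2.6: operators on fine-bond functions, localised by blocks) -/

/-- **the k-level geometry of an index, sites = the BLOCKS `y ∈ 𝔅`** (p21's `geomT D`: `Site := ↥(bset D)`, `scale y := j(y)`, `dist := d_T`),
`η := |c_f|⁻¹`, `M := L·M_h`; `Loc :=` the functions `J` on the FINE bonds, `suppIn J y′` = «supp J ⊂ Δ(y′)» («Δ(y) = B^j(y) if y ∈ Λ_j»: every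
bond where `J ≠ 0` lies in the block `y′`), `supNorm J = |J| := sup|J(x)|`, `l2Norm J = ‖J‖ := (Σ_x J(x)²)^{1/2}` (flat), `holder ε J = ‖J‖^{ξ′}_ε :=`
sup over admissible ordered pairs of `t^{−ε}|J(x) − J(x′)|`; `Cut` slots as in `kGeo`: `cutIn ζ y` = «every fine bond where `ζ ≠ 0` lies in a
block within torus distance 1 of `y`» (⊇ Δ̃(y)), `cutH α ζ = |ζ| + ‖ζ‖^ξ_α`, `cutSup ζ = |ζ|`.
[cite: Balaban1984PropagatorsII, (2.1)–(2.4) p.224, (2.45)–(2.46) pp.229–230, p.232 («Δ(y) = B^j(y)»), (2.136)–(2.140) p.247; Balaban1984PropagatorsI, (1.109) p.35] -/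
@[reducible] def kGeoG (i : KIdx d ℓ hd hL b₀ b₁) : B6.Geometry where
  Site := (geomT i.D).Site
  fin := inferInstance
  scale := fun y => y.1.1
  dist := fun y y' => (geomT i.D).dist y y'
  k := i.k
  eta := |i.cf|⁻¹
  L := ((ℓ + 1 : ℕ) : ℝ)
  R := i.R
  M := ((ℓ + 1 : ℕ) : ℝ) * (i.Mh : ℝ)
  Hyp21_22 := True
  Loc := PBond (PV d ℓ i.m i.K hd hL) 0 → ℝ
  suppIn := fun J y' => ∀ x, J x ≠ 0 → blkV1 i.hN i.D x = y'
  supNorm := fun J => ⨆ x, |J x|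
  l2Norm := fun J => Real.sqrt (∑ x, J x ^ 2)
  holder := fun ε J =>
    ⨆ q : PBond (PV d ℓ i.m i.K hd hL) 0 × PBond (PV d ℓ i.m i.K hd hL) 0, if Adm i q.1 q.2 then tpar i q.1 q.2 ^ (-ε) * |J q.1 - J q.2| else 0
  Cut := PBond (PV d ℓ i.m i.K hd hL) 0 → ℝ
  cutIn := fun ζ y => ∀ f, ζ f ≠ 0 → (geomT i.D).dist (blkV1 i.hN i.D f) y ≤ 1
  cutH := fun α ζ => (⨆ f, |ζ f|) +
    ⨆ q : PBond (PV d ℓ i.m i.K hd hL) 0 × PBond (PV d ℓ i.m i.K hd hL) 0, if Adm i q.1 q.2 then tpar i q.1 q.2 ^ (-α) * |ζ q.1 - ζ q.2| else 0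
  cutSup := fun ζ => ⨆ f, |ζ f|

/-- `(L^{scale}η)(y) = L^{j(y)}/|c_f|`. [cite: Balaban1984PropagatorsII, (2.1) p.224] -/
theorem lenG_eq (i : KIdx d ℓ hd hL b₀ b₁) (y : (geomT i.D).Site) :
    (kGeoG i).len y = (((ℓ + 1 : ℕ) : ℝ)) ^ y.1.1 / |i.cf| := by
  show (((ℓ + 1 : ℕ) : ℝ)) ^ y.1.1 * |i.cf|⁻¹ = _
  rw [div_eq_mul_inv]

/-- `(L^{scale}η)(y) > 0`. [cite: Balaban1984PropagatorsII, (2.1) p.224, bookkeeping] -/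
theorem lenG_pos (i : KIdx d ℓ hd hL b₀ b₁) (y : (geomT i.D).Site) : 0 < (kGeoG i).len y := by
  rw [lenG_eq]
  have : 0 < |i.cf| := abs_pos.2 i.hcf
  positivity

/-- `(L^{scale}η)(y) = (geomT D).len y · |c_f|⁻¹` — the output prefactor of the k-level (2.136) files (`B6Prop26GradKLevelV1` &c.).
[cite: Balaban1984PropagatorsII, (2.1) p.224, (2.136) p.247, dictionary] -/
theorem lenG_eq_geomT (i : KIdx d ℓ hd hL b₀ b₁) (y : (geomT i.D).Site) :
    (kGeoG i).len y = (geomT i.D).len y * |i.cf|⁻¹ := by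
  show (((ℓ + 1 : ℕ) : ℝ)) ^ y.1.1 * |i.cf|⁻¹ = ((ℓ : ℝ) + 1) ^ y.1.1 * 1 * |i.cf|⁻¹
  push_cast
  ring

/-- `|J(x)| ≤ |J|`. [cite: Balaban1984PropagatorsII, p.231 («|λ| = sup|λ(x)|»), bookkeeping] -/
theorem abs_le_supNormG (i : KIdx d ℓ hd hL b₀ b₁) (J : PBond (PV d ℓ i.m i.K hd hL) 0 → ℝ) (x : PBond (PV d ℓ i.m i.K hd hL) 0) :
    |J x| ≤ (kGeoG i).supNorm J :=
  le_ciSup (f := fun x => |J x|) (Set.finite_range _).bddAbove x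

/-- `0 ≤ |J|`. [cite: Balaban1984PropagatorsII, p.231, bookkeeping] -/
theorem supNormG_nonneg (i : KIdx d ℓ hd hL b₀ b₁) (J : PBond (PV d ℓ i.m i.K hd hL) 0 → ℝ) : 0 ≤ (kGeoG i).supNorm J :=
  Real.iSup_nonneg fun _ => abs_nonneg _

/-- **«supp J ⊂ Δ(y′)» IS A `BlockSupp`**: the census hypothesis `(kGeoG i).suppIn J y′` gives `BlockSupp (blkV1) J y′ |J|` — the input of every
k-level `HasMajorant` statement (`B6RandomWalk.HasMajorant`: «|(Tλ)(x)| ≤ K(y, y′)|λ|, x ∈ B^j(y), supp λ ⊂ B^{j′}(y′)»).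
[cite: Balaban1984PropagatorsII, (2.51) p.232, (2.136) p.247] -/
theorem blockSupp_of_suppIn (i : KIdx d ℓ hd hL b₀ b₁) {J : PBond (PV d ℓ i.m i.K hd hL) 0 → ℝ} {y' : (geomT i.D).Site}
    (h : (kGeoG i).suppIn J y') : BlockSupp (g := geomT i.D) (blkV1 i.hN i.D) J y' ((kGeoG i).supNorm J) := by
  refine ⟨supNormG_nonneg i J, fun x _ => abs_le_supNormG i J x, fun x hx => ?_⟩
  by_contra hJ
  exact hx (h x hJ)

end Literature.MathematicalPhysics.QuantumFieldTheory.Balaban1983to89.B6KLevelCensusIndexV1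

end
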